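import Literature.AlgebraicGeometry.HodgeTheory.CMHodgeGroupDerivedAlgebra
import HarnessLib

/-!
# Irreducibility of the eigenspaces `W_σ` of a CM field under an admissible Lie algebra, for any degree
# (Gordon 1997 §6; Zarhin 1983 §2; Moonen–Zarhin 1999 §2)

Family `hodge`, layer `Literature/AlgebraicGeometry/HodgeTheory` (cell `pub-hodgeav-hg6`, req-37 (A) Q2b, TABLE X rows 10 / 12
ALL MEMBERS: the irreducibility input `hirr` of `CMNoTwist.*` / `CMDerived.*`). UNCONDITIONAL; theorems only, no definition,
no named fact, no `sorry`. HONEST FRAMING of that cell: HC / HC_AV / HC_CM / H2 NOT proved.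

This is the tree's `QuarticTheta.eq_bot_or_eq_of_stable` (`Motives/HodgeThetaSubalgebraUnitaryQuartic`, where
`E = ℚ + ℚφ + ℚφ² + ℚφ³` is hard-wired as `Fin 4`) for `E = Σ_{k < m} ℚ φ^k` with `m` arbitrary — the proof is copied
verbatim (adapted from `Motives/HodgeThetaSubalgebraUnitaryQuartic.lean`, §3), the only change being the scalar lemma
`CMIrred.exists_smul_of_mem_span_endAlg` — together with the corollary that supplies the `𝔤`-stable complement
`R = ⊕_{c′ ≠ μ k} W_{c′}` from a CM type:
* `CMIrred.exists_smul_of_mem_span_endAlg` — elements of `E_ℂ` act on each `W_c` by scalars;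
* `CMIrred.eq_bot_or_eq_of_stable` — a `𝔤`-stable `U ≤ W_c` with a `𝔤`-stable complement `R` of `W_c` is `0` or `W_c`;
* **`CMIrred.eigenspace_irreducible`** — for a CM type `μ : ι → ℂ` (all `W_{μ k}, W_{conj μ k}` spanning `V_ℂ`), every
  `W_{μ k}` is `𝔤`-irreducible, for ANY admissible `𝔤` (commuting with `E`, `ψ`-skew) with `Θ ∈ 𝔤_ℂ`.

## References
* [Gordon1997] B. B. Gordon, arXiv:alg-geom/9709030, §6 (proof of Thm. 6.3.3, p. 19).
* [Zarhin1983HodgeGroupsK3] Yu. G. Zarhin, J. reine angew. Math. 341 (1983), §2.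
* [VoisinHodgeI2002] C. Voisin, Hodge Theory I, §7.1.2 Def. 7.7.
* [MoonenZarhin1999LowDim] B. Moonen, Yu. Zarhin, Math. Ann. 315 (1999), §2 (2.3).
* [Deligne1982HodgeCycles] P. Deligne, LNM 900 (1982), §4 (p. 30).
-/

noncomputable section

open scoped TensorProduct
open Module

namespace Literature.AlgebraicGeometry.Motives

namespace HodgeStructure

universe u

variable {V : Type u} [AddCommGroup V] [Module ℚ V] {n : ℤ}

/-- **Elements of `E_ℂ = span_ℂ {a_ℂ : a ∈ End_Hdg(V)}` act on each `W_c` by scalars** (`E = ℚ[φ]`, any degree).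
[cite: Deligne1982HodgeCycles, §4 (p. 30)] -/
theorem CMIrred.exists_smul_of_mem_span_endAlg (H : HodgeStructure V n) {φ : Module.End ℚ V} {m : ℕ}
    (hE : ∀ a ∈ H.endAlg, ∃ q : Fin m → ℚ, a = ∑ k, q k • φ ^ (k : ℕ)) {T : Module.End ℂ (ℂ ⊗[ℚ] V)}
    (hT : T ∈ Submodule.span ℂ ((fun a : Module.End ℚ V => a.baseChange ℂ) '' (H.endAlg : Set _))) (c : ℂ) :
    ∃ s : ℂ, ∀ w ∈ Module.End.eigenspace (φ.baseChange ℂ) c, T w = s • w := by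
  induction hT using Submodule.span_induction with
  | mem Z hZ =>
    obtain ⟨a, ha, rfl⟩ := hZ
    exact CMTheta.exists_smul_of_mem_endAlg H hE ha c
  | zero => exact ⟨0, fun w _ => by rw [LinearMap.zero_apply, zero_smul]⟩
  | add Z Z' _ _ hZ hZ' =>
    obtain ⟨s, hs⟩ := hZ
    obtain ⟨s', hs'⟩ := hZ'
    exact ⟨s + s', fun w hw => by rw [LinearMap.add_apply, hs w hw, hs' w hw, add_smul]⟩
  | smul a Z _ hZ =>
    obtain ⟨s, hs⟩ := hZ
    exact ⟨a * s, fun w hw => by rw [LinearMap.smul_apply, hs w hw, smul_smul]⟩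

-- adapted from Motives/HodgeThetaSubalgebraUnitaryQuartic.lean (`QuarticTheta.eq_bot_or_eq_of_stable`), `m` general
/-- **Irreducibility of an eigenspace `W_c` under `𝔤`** (any degree `m`). Let `R` be a `𝔤`-stable complement of `W_c` in
`V_ℂ`. A subspace `U ≤ W_c` stable under the `X_ℂ`, `X ∈ 𝔤`, is `0` or `W_c`: `U` is `Θ`-graded (`Θ ∈ 𝔤_ℂ`),
`U† = {y ∈ W_c : ψ_ℂ(y, conj U) = 0}` is stable (the `X_ℂ` are real and skew) with `U ∩ U† = 0` (second Hodge–Riemann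
relation on the graded pieces) and `dim U† ≥ dim W_c - dim U`, so `V_ℂ = U ⊕ (U† ⊕ R)` and the projector onto `U` commutes
with `𝔤`, hence lies in `E_ℂ` (`ThetaSubalgebra.mem_span_endAlg_of_forall_commute`), hence is a scalar on `W_c`.
[cite: Gordon1997, §6 (proof of Thm. 6.3.3, p. 19)] [cite: Zarhin1983HodgeGroupsK3, §2] [cite: VoisinHodgeI2002, §7.1.2 Def. 7.7] -/
theorem CMIrred.eq_bot_or_eq_of_stable [Module.Finite ℚ V] (H : HodgeStructure V n) (hn : n = 1)
    (heff : H.IsEffective) (ψ : H.Polarization) {φ : Module.End ℚ V} (hφE : φ ∈ H.endAlg)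
    {m : ℕ} (hE : ∀ a ∈ H.endAlg, ∃ q : Fin m → ℚ, a = ∑ k, q k • φ ^ (k : ℕ))
    (𝔤 : Submodule ℚ (Module.End ℚ V)) {Θ : Module.End ℂ (ℂ ⊗[ℚ] V)}
    (hΘ : ∀ p, ∀ x ∈ H.piece p (n - p), Θ x = ((2 * p - n : ℤ) : ℂ) • x) (hΘ𝔤 : Θ ∈ spanC 𝔤)
    (hcomm : ∀ X ∈ 𝔤, ∀ a : H.endAlg, X * (a : Module.End ℚ V) = (a : Module.End ℚ V) * X)
    (hskew : ∀ X ∈ 𝔤, ∀ v w, ψ.form (X v) w + ψ.form v (X w) = 0)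
    {c : ℂ} {R : Submodule ℂ (ℂ ⊗[ℚ] V)} (hR : ∀ X ∈ 𝔤, ∀ r ∈ R, X.baseChange ℂ r ∈ R)
    (hcR : IsCompl (Module.End.eigenspace (φ.baseChange ℂ) c) R)
    {U : Submodule ℂ (ℂ ⊗[ℚ] V)} (hUW : U ≤ Module.End.eigenspace (φ.baseChange ℂ) c)
    (hU : ∀ X ∈ 𝔤, ∀ u ∈ U, X.baseChange ℂ u ∈ U) :
    U = ⊥ ∨ U = Module.End.eigenspace (φ.baseChange ℂ) c := by
  subst hn
  classical
  set W := Module.End.eigenspace (φ.baseChange ℂ) c with hWdef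
  set ψC := ψ.form.baseChange ℂ with hψC
  obtain ⟨hP, hQ, -, -, -⟩ := UnitaryTheta.theta_facts H rfl heff hΘ
  have hPQ : ∀ v, (2 : ℂ)⁻¹ • (v + Θ v) + (2 : ℂ)⁻¹ • (v - Θ v) = v := fun v => by module
  -- stability under `𝔤_ℂ ∋ Θ`; graded pieces
  have hXW : ∀ X ∈ 𝔤, ∀ w ∈ W, X.baseChange ℂ w ∈ W := fun X hX w hw =>
    UnitaryTheta.apply_mem_eigenspace_of_commute (UnitaryTheta.baseChange_commute H hφE hcomm hX) hw
  have hXskew : ∀ X ∈ 𝔤, ∀ x y, ψC (X.baseChange ℂ x) y + ψC x (X.baseChange ℂ y) = 0 :=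
    fun X hX => ThetaSubalgebra.formBaseChange_add_eq_zero_of_skew ψ (hskew X hX)
  have hgraded : ∀ T : Submodule ℂ (ℂ ⊗[ℚ] V), (∀ X ∈ 𝔤, ∀ u ∈ T, X.baseChange ℂ u ∈ T) →
      ∀ u ∈ T, (2 : ℂ)⁻¹ • (u + Θ u) ∈ T ∧ (2 : ℂ)⁻¹ • (u - Θ u) ∈ T := by
    intro T hT u hu
    have hΘu : Θ u ∈ T := mapsTo_of_mem_spanC (T := T) (fun X hX => fun u hu => hT X hX u hu) hΘ𝔤 hu
    exact ⟨Submodule.smul_mem _ _ (Submodule.add_mem _ hu hΘu),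
      Submodule.smul_mem _ _ (Submodule.sub_mem _ hu hΘu)⟩
  -- the trivial case
  by_cases hU0 : U = ⊥
  · exact Or.inl hU0
  right
  obtain ⟨u₀, hu₀U, hu₀0⟩ := (Submodule.ne_bot_iff U).1 hU0
  -- the `h`-orthogonal `U† = {y ∈ W : ψ_ℂ(y, conj U) = 0}`
  set Ud : Submodule ℂ (ℂ ⊗[ℚ] V) :=
    W ⊓ ⨅ u : U, LinearMap.ker (ψC.flip (conj (u : ℂ ⊗[ℚ] V))) with hUddef
  have hmemUd : ∀ y, y ∈ Ud ↔ y ∈ W ∧ ∀ u ∈ U, ψC y (conj u) = 0 := fun y => by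
    simp only [hUddef, Submodule.mem_inf, Submodule.mem_iInf, LinearMap.mem_ker, Subtype.forall]
    exact Iff.rfl
  have hUdW : Ud ≤ W := inf_le_left
  have hXUd : ∀ X ∈ 𝔤, ∀ y ∈ Ud, X.baseChange ℂ y ∈ Ud := by
    intro X hX y hy
    rw [hmemUd] at hy ⊢
    refine ⟨hXW X hX y hy.1, fun u hu => ?_⟩
    have h := hXskew X hX y (conj u)
    rwa [← conj_baseChange, hy.2 _ (hU X hX u hu), add_zero] at h
  -- `U ∩ U† = 0`
  have hUUd : ∀ u ∈ U, u ∈ Ud → u = 0 := by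
    intro u hu hud
    have key : ∀ z ∈ U, z ∈ Ud → ∀ p q : ℤ, p + q = 1 → z ∈ H.piece p q → z = 0 := by
      intro z hz hzd p q hpq hzpq
      by_contra hz0
      exact ψ.form_conj_ne_zero hpq hzpq hz0 (((hmemUd z).1 hzd).2 z hz)
    have h1 := key _ (hgraded U hU u hu).1 (hgraded Ud hXUd u hud).1 1 0 (by norm_num) (hP u)
    have h2 := key _ (hgraded U hU u hu).2 (hgraded Ud hXUd u hud).2 0 1 (by norm_num) (hQ u)
    rw [← hPQ u, h1, h2, add_zero]
  -- `dim W ≤ dim U + dim U†`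
  have hdim : Module.finrank ℂ W ≤ Module.finrank ℂ U + Module.finrank ℂ Ud := by
    set b := Module.finBasis ℂ U with hbdef
    set f : W →ₗ[ℂ] (Fin (Module.finrank ℂ U) → ℂ) :=
      LinearMap.pi fun i => (ψC.flip (conj (b i : ℂ ⊗[ℚ] V))).comp W.subtype with hfdef
    have hf : ∀ (w : W) i, f w i = ψC w (conj (b i : ℂ ⊗[ℚ] V)) := fun w i => rfl
    have hker : LinearMap.ker f ≤ Ud.comap W.subtype := by
      intro w hw
      rw [LinearMap.mem_ker] at hw
      rw [Submodule.mem_comap, Submodule.subtype_apply, hmemUd]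
      refine ⟨w.2, fun u hu => ?_⟩
      have hu' : u = ∑ i, b.repr ⟨u, hu⟩ i • (b i : ℂ ⊗[ℚ] V) := by
        have h := congrArg Subtype.val (b.sum_repr ⟨u, hu⟩).symm
        simpa only [Submodule.coe_sum, Submodule.coe_smul] using h
      rw [hu', map_sum, map_sum]
      refine Finset.sum_eq_zero fun i _ => ?_
      have hi := congrFun hw i
      rw [Pi.zero_apply, hf] at hi
      rw [conj_smul, map_smul, smul_eq_mul, hi, mul_zero]
    have h1 := LinearMap.finrank_range_add_finrank_ker f
    have h2 : Module.finrank ℂ (LinearMap.range f) ≤ Module.finrank ℂ U :=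
      (Submodule.finrank_le _).trans (Module.finrank_fin_fun ℂ).le
    have h3 : Module.finrank ℂ (LinearMap.ker f) ≤ Module.finrank ℂ Ud :=
      (Submodule.finrank_mono hker).trans (Submodule.comapSubtypeEquivOfLe hUdW).finrank_eq.le
    omega
  -- `W = U ⊕ U†`
  have hsup : U ⊔ Ud = W := by
    refine Submodule.eq_of_le_of_finrank_le (sup_le hUW hUdW) ?_
    have h := Submodule.finrank_sup_add_finrank_inf_eq U Ud
    have h0 : U ⊓ Ud = ⊥ := by
      rw [eq_bot_iff]
      intro u hu
      rw [Submodule.mem_bot]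
      exact hUUd u hu.1 hu.2
    rw [h0, finrank_bot, add_zero] at h
    omega
  -- `V_ℂ = U ⊕ (U† ⊕ R)`
  have hc : IsCompl U (Ud ⊔ R) := by
    refine IsCompl.of_le (fun x hx => ?_) (fun x _ => ?_)
    · obtain ⟨hxU, hx2⟩ := Submodule.mem_inf.1 hx
      obtain ⟨y, hy, z, hz, rfl⟩ := Submodule.mem_sup.1 hx2
      have hzW : z ∈ W := by
        have h : y + z - y ∈ W := Submodule.sub_mem _ (hUW hxU) (hUdW hy)
        rwa [add_sub_cancel_left] at h
      have hz0 : z = 0 := by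
        have h := hcR.disjoint
        rw [Submodule.disjoint_def] at h
        exact h z hzW hz
      rw [hz0, add_zero] at hxU ⊢
      rw [Submodule.mem_bot]
      exact hUUd y hxU hy
    · have hx : x ∈ W ⊔ R := hcR.sup_eq_top ▸ Submodule.mem_top
      obtain ⟨w, hw, r, hr, rfl⟩ := Submodule.mem_sup.1 hx
      rw [← sup_assoc, hsup]
      exact Submodule.add_mem_sup hw hr
  -- the projector onto `U` commutes with `𝔤`
  set π := U.projection (Ud ⊔ R) hc with hπ
  have hπcomm : ∀ X ∈ 𝔤, π * X.baseChange ℂ = X.baseChange ℂ * π := by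
    intro X hX
    refine LinearMap.ext fun x => ?_
    rw [Module.End.mul_apply, Module.End.mul_apply]
    have hx : x = π x + (x - π x) := by abel
    have h1 : π x ∈ U := Submodule.projection_apply_mem hc x
    have h2 : X.baseChange ℂ (x - π x) ∈ Ud ⊔ R := by
      obtain ⟨y, hy, z, hz, hyz⟩ := Submodule.mem_sup.1 (Submodule.sub_projection_mem hc x)
      rw [← hyz, map_add]
      exact Submodule.add_mem_sup (hXUd X hX y hy) (hR X hX z hz)
    conv_lhs => rw [hx]
    rw [map_add, map_add, Submodule.projection_apply_of_mem_left hc (hU X hX _ h1),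
      (Submodule.projection_apply_eq_zero_iff hc).2 h2, add_zero]
  -- hence lies in `E_ℂ` and is a scalar on `W`
  obtain ⟨s, hπW⟩ := CMIrred.exists_smul_of_mem_span_endAlg H hE
    (ThetaSubalgebra.mem_span_endAlg_of_forall_commute H 𝔤 hΘ hΘ𝔤 hπcomm) c
  have hs : s = 1 := by
    have h := hπW u₀ (hUW hu₀U)
    rw [Submodule.projection_apply_of_mem_left hc hu₀U] at h
    have h' : (s - 1) • u₀ = 0 := by rw [sub_smul, one_smul, ← h, sub_self]
    exact sub_eq_zero.1 ((smul_eq_zero.1 h').resolve_right hu₀0)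
  refine le_antisymm hUW fun w hw => ?_
  rw [← one_smul ℂ w, ← hs, ← hπW w hw]
  exact Submodule.projection_apply_mem hc w



/-- **Every `W_{μ k}` of a CM type is `𝔤`-irreducible** for any admissible `𝔤` with `Θ ∈ 𝔤_ℂ`: the complement
`R = ⊕_{c′ ≠ μ k} W_{c′}` (over the other eigenvalues `μ j`, `conj μ j`) is `𝔤`-stable and complementary by the
independence of eigenspaces. [cite: Gordon1997, §6 (proof of Thm. 6.3.3, p. 19)] [cite: MoonenZarhin1999LowDim, §2 (2.3)] -/
theorem CMIrred.eigenspace_irreducible [Module.Finite ℚ V] {ι : Type} [Fintype ι] [DecidableEq ι]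
    (H : HodgeStructure V n) (hn : n = 1) (heff : H.IsEffective) (ψ : H.Polarization) {φ : Module.End ℚ V}
    (hφE : φ ∈ H.endAlg) {m : ℕ} (hE : ∀ a ∈ H.endAlg, ∃ q : Fin m → ℚ, a = ∑ k, q k • φ ^ (k : ℕ))
    (μ : ι → ℂ) (hinj : Function.Injective μ) (hdist : ∀ k k', μ k' ≠ starRingEnd ℂ (μ k))
    (htop : (⨆ kt : ι × Fin 2, Module.End.eigenspace (φ.baseChange ℂ)
      (if kt.2 = 0 then μ kt.1 else starRingEnd ℂ (μ kt.1))) = ⊤)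
    (𝔤 : Submodule ℚ (Module.End ℚ V)) {Θ : Module.End ℂ (ℂ ⊗[ℚ] V)}
    (hΘ : ∀ p, ∀ x ∈ H.piece p (n - p), Θ x = ((2 * p - n : ℤ) : ℂ) • x) (hΘ𝔤 : Θ ∈ spanC 𝔤)
    (hcomm : ∀ X ∈ 𝔤, ∀ a : H.endAlg, X * (a : Module.End ℚ V) = (a : Module.End ℚ V) * X)
    (hskew : ∀ X ∈ 𝔤, ∀ v w, ψ.form (X v) w + ψ.form v (X w) = 0) (k : ι)
    (U : Submodule ℂ (ℂ ⊗[ℚ] V)) (hUW : U ≤ Module.End.eigenspace (φ.baseChange ℂ) (μ k))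
    (hU : ∀ X ∈ 𝔤, ∀ u ∈ U, X.baseChange ℂ u ∈ U) :
    U = ⊥ ∨ U = Module.End.eigenspace (φ.baseChange ℂ) (μ k) := by
  classical
  set ev : ι × Fin 2 → ℂ := fun kt => if kt.2 = 0 then μ kt.1 else starRingEnd ℂ (μ kt.1) with hevdef
  have hev0 : ev (k, 0) = μ k := by simp [hevdef]
  have hev : Function.Injective ev := by
    rintro ⟨k₁, t₁⟩ ⟨k₂, t₂⟩ h
    simp only [hevdef] at h
    rcases Fin.exists_fin_two.1 ⟨t₁, rfl⟩ with rfl | rfl <;> rcases Fin.exists_fin_two.1 ⟨t₂, rfl⟩ with rfl | rfl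
    · simp only [if_true] at h; rw [hinj h]
    · simp only [if_true, show (1 : Fin 2) ≠ 0 from by decide, if_false] at h; exact absurd h (hdist k₂ k₁)
    · simp only [if_true, show (1 : Fin 2) ≠ 0 from by decide, if_false] at h; exact absurd h.symm (hdist k₁ k₂)
    · simp only [show (1 : Fin 2) ≠ 0 from by decide, if_false] at h; rw [hinj ((starRingEnd ℂ).injective h)]
  -- the complement `R = ⊕_{kt ≠ (k,0)} W_{ev kt}`
  set R : Submodule ℂ (ℂ ⊗[ℚ] V) := ⨆ (kt : ι × Fin 2) (_ : kt ≠ (k, 0)), Module.End.eigenspace (φ.baseChange ℂ) (ev kt)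
    with hRdef
  have hind : iSupIndep fun kt => Module.End.eigenspace (φ.baseChange ℂ) (ev kt) :=
    (Module.End.eigenspaces_iSupIndep (φ.baseChange ℂ)).comp hev
  have hcR : IsCompl (Module.End.eigenspace (φ.baseChange ℂ) (μ k)) R := by
    refine ⟨?_, ?_⟩
    · rw [← hev0]; exact hind (k, 0)
    · rw [codisjoint_iff, eq_top_iff, ← htop]
      refine iSup_le fun kt => ?_
      by_cases hkt : kt = (k, 0)
      · subst hkt
        have h : Module.End.eigenspace (φ.baseChange ℂ) (ev (k, 0)) ≤ Module.End.eigenspace (φ.baseChange ℂ) (μ k) ⊔ R := by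
          rw [hev0]; exact le_sup_left
        exact h
      · exact le_sup_of_le_right (le_iSup₂_of_le kt hkt le_rfl)
  have hR : ∀ X ∈ 𝔤, ∀ r ∈ R, X.baseChange ℂ r ∈ R := by
    intro X hX r hr
    have hXφ := UnitaryTheta.baseChange_commute H hφE hcomm hX
    refine Submodule.iSup_induction (motive := fun r => X.baseChange ℂ r ∈ R) _ hr ?_ (by
      rw [map_zero]; exact R.zero_mem) (fun x y hx hy => by rw [map_add]; exact R.add_mem hx hy)
    intro kt r hr
    refine Submodule.iSup_induction (motive := fun r => X.baseChange ℂ r ∈ R) _ hr ?_ (by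
      rw [map_zero]; exact R.zero_mem) (fun x y hx hy => by rw [map_add]; exact R.add_mem hx hy)
    intro hkt r hr
    exact Submodule.mem_iSup_of_mem kt (Submodule.mem_iSup_of_mem hkt
      (UnitaryTheta.apply_mem_eigenspace_of_commute hXφ hr))
  exact CMIrred.eq_bot_or_eq_of_stable H hn heff ψ hφE hE 𝔤 hΘ hΘ𝔤 hcomm hskew hR hcR hUW hU

end HodgeStructure

end Literature.AlgebraicGeometry.Motives
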